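import Mathlib
import Summits.Ventures.PercRepro2.TBFav

/-!
# The family of record: favourable events plus a two-colour avoid set at ONE root — `TBFavX`
(blind cell PercRepro2, mine-c g19, 2026-08-25; `conjectures/MINE-C.md` §28.15)

`TBFav` (favourable events on any vertices) extends, in census, by a TWO-COLOUR AVOID SET at one
root: `X₂` avoided by both clusters of `a₂` (`M_r ∩ X₂ = ∅ = M_b ∩ X₂`, the (TB13)-style
conditioning of row 2′TB13 transplanted to row 2′TB) or, by the mirror, `X₁` avoided by both
clusters of `a₁` — but not both at once (two-sided avoidance fails on the 6-path
`a₁ – b – y₁ – y₂ – o – a₂`, §28.4).  Census: every `|X| ≤ 3` at n = 7 m ≤ 11, combined with every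
favourable single constraint at n = 7 m ≤ 10, 0 failures.  `TBFav_of_TBFavX`: the case
`X₁ = X₂ = ∅` is `TBFav`.  Own work; standard axioms; no proof of the candidate is claimed.
-/

namespace Summit.Ventures.PercRepro2

namespace FavCond

open CovForm A3InactiveTyped TB14Cut

section KernelX

variable {V : Type*} {E : Type*} {R : Type*} [Field R]

/-- The two-colour avoidance indicator of a set `X` for the root `a`:
`Π_{x ∈ X} (1 − 1[x ∈ C_y(a)]) (1 − 1[x ∈ C_w(a)])` (`x` in neither cluster of `a`). -/
noncomputable def avoidInd (ends : E → Sym2 V) (a : V) (X : Finset V) : Config E → Config E → R :=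
  fun y w => ∏ x ∈ X, ((1 - iH ends a x y) * (1 - iH ends a x w))

/-- The favourable kernel with avoid sets `X₁` (at `a₁`) and `X₂` (at `a₂`). -/
noncomputable def favKX (ends : E → Sym2 V) (a₁ a₂ o : V) (X₁ X₂ : Finset V) (S : Finset V)
    (c : V → FavCon) : Config E → Config E → R :=
  fun y w => avoidInd ends a₁ X₁ y w * avoidInd ends a₂ X₂ y w * favK ends a₁ a₂ o S c y w

omit [Field R] in
/-- With an empty avoid set the avoidance indicator is `1`. -/
lemma avoidInd_empty [Field R] (ends : E → Sym2 V) (a : V) (y w : Config E) :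
    (avoidInd ends a ∅ y w : R) = 1 := by
  simp [avoidInd]

end KernelX

/-- **(TB-FAV+X), the family of record** (a Prop; NOT a theorem): favourable constraints on any
finite set `S` of vertices together with a two-colour avoid set at ONE root (`X₁ = ∅` or `X₂ = ∅`),
at every profile and every finite graph. -/
def TBFavX (R : Type*) [Field R] [LinearOrder R] : Prop :=
  ∀ (V E : Type) [Fintype V] [DecidableEq V] [Fintype E] [DecidableEq E] (ends : E → Sym2 V)
    (a₁ a₂ o : V) (X₁ X₂ S : Finset V) (c : V → FavCon) (F : Finset E) (z : Config E),
    (X₁ = ∅ ∨ X₂ = ∅) →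
    0 ≤ pairCount F z (favKX ends a₁ a₂ o X₁ X₂ S c : Config E → Config E → R)

section ReductionX

variable {V : Type} {E : Type} [Fintype E] [DecidableEq E] {R : Type*} [Field R]

omit [Fintype E] [DecidableEq E] in
/-- Without avoid sets the kernel `favKX` is `favK`. -/
lemma favKX_empty (ends : E → Sym2 V) (a₁ a₂ o : V) (S : Finset V) (c : V → FavCon)
    (y w : Config E) :
    (favKX ends a₁ a₂ o ∅ ∅ S c y w : R) = favK ends a₁ a₂ o S c y w := by
  simp only [favKX, avoidInd_empty, one_mul]

/-- **`TBFav` is the case `X₁ = X₂ = ∅` of `TBFavX`.** -/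
theorem TBFav_of_TBFavX [LinearOrder R] (h : TBFavX R) : TBFav R := by
  intro V E _ _ _ _ ends a₁ a₂ o S c F z
  have h1 := h V E ends a₁ a₂ o ∅ ∅ S c F z (Or.inl rfl)
  have : pairCount F z (favKX ends a₁ a₂ o ∅ ∅ S c : Config E → Config E → R) =
      pairCount F z (favK ends a₁ a₂ o S c) := by
    congr 1
    funext y w
    exact favKX_empty ends a₁ a₂ o S c y w
  rw [this] at h1
  exact h1

end ReductionX

end FavCond

end Summit.Ventures.PercRepro2
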